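import Mathlib
import Literature.NumberTheory.LFunctions.Zhang2022.SkeletonEvalRelE
import HarnessLib

/-!
# Zhang (2022), typed skeleton — the main-order constant `c₂₃₂` of (2.32), parametrised (RT-08 decl of record)

Topic `Literature/NumberTheory/LFunctions/Zhang2022` (Landau–Siegel audit tree; verdict-neutral).
Y. Zhang, *Discrete mean estimates and the Landau–Siegel zero*, arXiv:2211.02515v1 (2022)
[Zhang2022LandauSiegel] — **an unrefereed manuscript under adjudication.** Statement-only.

ZHANG-L ruling R-35c/R-35d (zl-lead, 2026-08-27): the main-order constant of the left side of (2.32) that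
the typed §8–§18 evaluation chain ACTUALLY produces — (8.23) `Ξ₁₁ ∼ 𝔠₁𝔞𝔓`, (9.7) read with `𝔠₂ := k`,
(18.1)ᴿ `‖Ξ₁₃ − 𝔠₃𝔞𝔓‖ ≤ 10⁻⁵𝔞𝔓 + o((𝔞+1)𝔓)` with `𝔠₃ := frakc3E e1pp` — is
`c232E e1pp k := 𝔠₁ + k + 2(Re 𝔠₃ + 10⁻⁵)` (tolerance of the banked (18.1) node INCLUDED). It is the
first argument of the lane's terminal hypothesis of record, E-105
`MainOrderContradiction (c232E e1ppD frakc2c.re) c_J` (`Section2MainOrder.MainOrderContradiction`, named by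
ls-theory), and the §18 margin in any reading is literally `c232E e1pp k < 0.001`
(`margin232WithE_iff_c232E_lt`, `Iff.rfl`). NO bridge to `Section2MainOrder.C232/C232c` (those use the
reduced `𝔠₃` of the display before (18.2): different numbers; identity for the record
`c232E e1pp k = 𝔠₁ + k + 2Re frakc3r + 2Re(identResidualE e1pp) + 2·10⁻⁵`, not needed by any chain).
Numerics of record (zl-w15-ref-1, p479078): `¬ MainOrderContradiction (c232E e1ppD frakc2c.re) C233` and at
`8800/π` — never used by a chain.

## References

* Y. Zhang, arXiv:2211.02515v1 (2022), §18 (18.1) and p. 100 ("𝔠₁ + 𝔠₂ + 2Re 𝔠₃ < 0.001"), §2 (2.32).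
  [cite: Zhang2022LandauSiegel, §18 p. 100]
-/

noncomputable section

namespace Literature.NumberTheory.LFunctions.Zhang2022.Skeleton

/-- **`c₂₃₂` of the typed chain**: `𝔠₁ + k + 2(Re 𝔠₃ + 10⁻⁵)` with `𝔠₂ := k` and `𝔠₃ := frakc3E e1pp`
(ZHANG-L R-35c decl of record; instance of record `k = frakc2c.re`, `e1pp = e1ppD`).
[cite: Zhang2022LandauSiegel, §18 p. 100] -/
def c232E (e1pp : ℕ → ℂ) (k : ℝ) : ℝ := frakc1.re + k + 2 * ((frakc3E e1pp).re + 1e-5)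

/-- Unfolding. [cite: Zhang2022LandauSiegel, §18 p. 100] -/
theorem c232E_eq (e1pp : ℕ → ℂ) (k : ℝ) :
    c232E e1pp k = frakc1.re + k + 2 * ((frakc3E e1pp).re + 1e-5) := rfl

/-- The §18 margin in the reading `(e1pp, k)` IS `c232E e1pp k < 0.001`.
[cite: Zhang2022LandauSiegel, §18 p. 100] -/
theorem margin232WithE_iff_c232E_lt (e1pp : ℕ → ℂ) (k : ℝ) :
    Margin232WithE e1pp k ↔ c232E e1pp k < 0.001 := Iff.rfl

/-- In particular the banked printed-value margin: `Margin232With k ↔ c232E e1ppj k < 0.001`.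
[cite: Zhang2022LandauSiegel, §18 p. 100] -/
theorem margin232With_iff_c232E_lt (k : ℝ) : Margin232With k ↔ c232E e1ppj k < 0.001 := Iff.rfl

end Literature.NumberTheory.LFunctions.Zhang2022.Skeleton
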